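import Mathlib
import Summits.ValiantsHypothesis.ValiantsHypothesis.Cruxes.NNLinearDegreeCofactorHard.Lines.xc_division
import HarnessLib

/-!
# Flag exposure — the DIMENSION RUNG for `COR(n) + Q`, kernel pieces (val-idea-40 g0, crux stmt-ValiantsHypothesis-21181)

`xc(COR(n) + Q) + 1 ≥ 1.5^{n - dim Q}` for EVERY polytope `Q = conv{q_j}` (no genericity, no vertex count, no sign
pattern): one GENERIC functional in the normal cone of a coordinate face `F_{S,S'} ≅ COR(n - |S| - |S'|)` of `COR(n)`
exposes `F_{S,S'} + {point}` as soon as no two distinct generators of `Q` differ by a solution of the face's linear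
equations (`corPolytope_add_genericFace_three_pow_le`, the EXPOSURE RUNG), and the FLAG LEMMA supplies such a face with
`|S| ≤ dim Q`, `S' = ∅` (`corPolytope_add_three_pow_le_of_finrank`, the DIMENSION RUNG).  Currency: the flattened
`corPolytope n ⊂ ℝ^{n·n}` of `xc_division.lean` (PROP A/B live there); tools: `three_pow_le_of_add` (chamber pigeonhole),
`hasEFOfSize_face_add` (faces of Minkowski sums), `ud_data` (FMPTW's unique-disjointness data).
-/

namespace Summit.ValiantsHypothesis.ValiantsHypothesis.Cruxes.NNDivisionHard.ValIdea40.Flat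

open Matrix Finset
open scoped Pointwise
open Literature.Barriers.PneNP (HasEFOfSize)
open Literature.Combinatorics.Optimization (corPolytopeGraph)
open Literature.Combinatorics.Optimization.FixedSizePsdRank (Cube vecOuter bvec corPolytope flat
  flat_dotProduct_vecOuter)
open Summit.ValiantsHypothesis.ValiantsHypothesis.Cruxes.NNLinearDegreeCofactorHard.XcDivision

/-! ## §1 Genericity: avoiding finitely many linear coincidences -/

/-- a real `M > C` with `α M + β ≠ 0` for finitely many `(α, β) ≠ 0`. -/
theorem exists_large_avoid (s : Finset (ℝ × ℝ)) (hs : ∀ p ∈ s, p.1 ≠ 0 ∨ p.2 ≠ 0) (C : ℝ) :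
    ∃ M : ℝ, C < M ∧ ∀ p ∈ s, p.1 * M + p.2 ≠ 0 := by
  refine ⟨|C| + 1 + ∑ p ∈ s, |p.2 / p.1|, ?_, ?_⟩
  · have h1 : C ≤ |C| := le_abs_self C
    have h2 : 0 ≤ ∑ p ∈ s, |p.2 / p.1| := Finset.sum_nonneg fun p _ => abs_nonneg _
    linarith
  · intro p hp
    rcases eq_or_ne p.1 0 with h0 | h0
    · rcases hs p hp with h | h
      · exact absurd h0 h
      · rw [h0, zero_mul, zero_add]; exact h
    · have hle : |p.2 / p.1| ≤ ∑ p ∈ s, |p.2 / p.1| :=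
        Finset.single_le_sum (f := fun p : ℝ × ℝ => |p.2 / p.1|) (fun p _ => abs_nonneg _) hp
      have hC : 0 ≤ |C| := abs_nonneg C
      have hge : -|p.2 / p.1| ≤ p.2 / p.1 := neg_abs_le _
      have hpos : 0 < |C| + 1 + ∑ p ∈ s, |p.2 / p.1| + p.2 / p.1 := by linarith
      have heq : p.1 * (|C| + 1 + ∑ p ∈ s, |p.2 / p.1|) + p.2 =
          p.1 * (|C| + 1 + ∑ p ∈ s, |p.2 / p.1| + p.2 / p.1) := by
        field_simp
      rw [heq]
      exact mul_ne_zero h0 hpos.ne'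

/-- a GENERIC combination of finitely many test functions separates every test point that some test function sees. -/
theorem exists_generic_comb {K E : Type} [Fintype K] [DecidableEq K] (T : Finset E) (ψ : K → E → ℝ) :
    ∃ ε : K → ℝ, ∀ Δ ∈ T, (∃ t, ψ t Δ ≠ 0) → ∑ t, ε t * ψ t Δ ≠ 0 := by
  classical
  suffices h : ∀ s : Finset K, ∃ ε : K → ℝ, (∀ t ∉ s, ε t = 0) ∧
      ∀ Δ ∈ T, (∃ t ∈ s, ψ t Δ ≠ 0) → ∑ t, ε t * ψ t Δ ≠ 0 by
    obtain ⟨ε, -, hε⟩ := h Finset.univ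
    exact ⟨ε, fun Δ hΔ ⟨t, ht⟩ => hε Δ hΔ ⟨t, Finset.mem_univ t, ht⟩⟩
  intro s
  induction s using Finset.induction_on with
  | empty =>
    exact ⟨0, fun _ _ => rfl, fun Δ _ ⟨t, ht, _⟩ => absurd ht (by simp)⟩
  | insert a s ha ih =>
    obtain ⟨ε', hsupp, hsep⟩ := ih
    let pr : E → ℝ × ℝ := fun Δ => (ψ a Δ, ∑ t, ε' t * ψ t Δ)
    obtain ⟨τ, -, hτ⟩ := exists_large_avoid ((T.image pr).filter fun p => p.1 ≠ 0 ∨ p.2 ≠ 0)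
      (fun p hp => (Finset.mem_filter.1 hp).2) 0
    refine ⟨fun t => ε' t + (if t = a then τ else 0), ?_, ?_⟩
    · intro t ht
      rw [Finset.mem_insert, not_or] at ht
      show ε' t + (if t = a then τ else 0) = 0
      rw [hsupp t ht.2, if_neg ht.1, add_zero]
    · intro Δ hΔ hex
      have hsum : ∑ t, (ε' t + (if t = a then τ else 0)) * ψ t Δ =
          (∑ t, ε' t * ψ t Δ) + τ * ψ a Δ := by
        simp only [add_mul, Finset.sum_add_distrib, ite_mul, zero_mul, Finset.sum_ite_eq',
          Finset.mem_univ, if_true]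
      rw [hsum]
      by_cases hpair : ψ a Δ ≠ 0 ∨ ∑ t, ε' t * ψ t Δ ≠ 0
      · have hmem : pr Δ ∈ (T.image pr).filter fun p => p.1 ≠ 0 ∨ p.2 ≠ 0 :=
          Finset.mem_filter.2 ⟨Finset.mem_image_of_mem pr hΔ, hpair⟩
        have hne := hτ (pr Δ) hmem
        intro h0
        apply hne
        show ψ a Δ * τ + ∑ t, ε' t * ψ t Δ = 0
        linarith
      · push Not at hpair
        obtain ⟨t, ht, hne⟩ := hex
        rw [Finset.mem_insert] at ht
        rcases ht with rfl | ht
        · exact absurd hpair.1 hne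
        · exact absurd hpair.2 (hsep Δ hΔ ⟨t, ht, hne⟩)

/-! ## §2 The test functionals of the coordinate face `F_{S,S'}` -/

variable {n : ℕ}

/-- the coordinate functional `X ↦ X_{pq}` (flattened). -/
def ent (n : ℕ) (p q : Fin n) : Fin (n * n) → ℝ :=
  flat (fun i j => if i = p ∧ j = q then (1 : ℝ) else 0)

theorem ent_dot_udPt (p q : Fin n) (b : Finset (Fin n)) :
    ent n p q ⬝ᵥ udPt b = udInd b p * udInd b q := by
  unfold ent udPt
  rw [flat_dotProduct_vecOuter]
  rw [Finset.sum_eq_single_of_mem p (Finset.mem_univ p) (fun i _ hi => by simp [hi])]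
  rw [Finset.sum_eq_single_of_mem q (Finset.mem_univ q) (fun j _ hj => by simp [hj])]
  simp

theorem ent_dot (p q : Fin n) (x : Fin (n * n) → ℝ) :
    ent n p q ⬝ᵥ x = x (finProdFinEquiv (p, q)) := by
  unfold ent flat dotProduct
  rw [Finset.sum_eq_single_of_mem (finProdFinEquiv (p, q)) (Finset.mem_univ _)]
  · simp
  · intro i _ hi
    have : ¬ ((finProdFinEquiv.symm i).1 = p ∧ (finProdFinEquiv.symm i).2 = q) := by
      rintro ⟨h1, h2⟩
      apply hi
      have : finProdFinEquiv.symm i = (p, q) := Prod.ext h1 h2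
      rw [← this, Equiv.apply_symm_apply]
    show (if (finProdFinEquiv.symm i).1 = p ∧ (finProdFinEquiv.symm i).2 = q then (1 : ℝ) else 0) * x i = 0
    rw [if_neg this, zero_mul]

theorem udProd_mem (b : Finset (Fin n)) (p q : Fin n) :
    0 ≤ udInd b p * udInd b q ∧ udInd b p * udInd b q ≤ 1 := by
  rw [udInd_apply, udInd_apply]
  by_cases hp : p ∈ b <;> by_cases hq : q ∈ b <;> simp [hp, hq]

/-- the TEST FAMILY of the face `F_{S,S'}`: entries on `(S ∪ S')²`; for a free index `k`, the row couplings
`X_{pk} - X_{kk}` (`p ∈ S`) and `X_{pk}` (`p ∈ S'`).  Each is CONSTANT on the vertices of the face. -/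
def psi (S S' : Finset (Fin n)) : Bool × Fin n × Fin n → (Fin (n * n) → ℝ)
  | (false, p, q) => if p ∈ S ∪ S' ∧ q ∈ S ∪ S' then ent n p q else 0
  | (true, p, k) => if k ∈ S ∪ S' then 0 else
      if p ∈ S then ent n p k - ent n k k else if p ∈ S' then ent n p k else 0

theorem psi_abs_le (S S' : Finset (Fin n)) (t : Bool × Fin n × Fin n) (b : Finset (Fin n)) :
    |psi S S' t ⬝ᵥ udPt b| ≤ 1 := by
  obtain ⟨c, p, q⟩ := t
  cases c
  · simp only [psi]
    split_ifs
    · rw [ent_dot_udPt]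
      have h1 := udProd_mem b p q
      rw [abs_le]; constructor <;> linarith [h1.1, h1.2]
    · simp
  · simp only [psi]
    split_ifs
    · simp
    · rw [sub_dotProduct, ent_dot_udPt, ent_dot_udPt]
      have h1 := udProd_mem b p q
      have h2 := udProd_mem b q q
      rw [abs_le]; constructor <;> linarith [h1.1, h1.2, h2.1, h2.2]
    · rw [ent_dot_udPt]
      have h1 := udProd_mem b p q
      rw [abs_le]; constructor <;> linarith [h1.1, h1.2]
    · simp

theorem psi_face (S S' : Finset (Fin n)) (hSS' : Disjoint S S') (t : Bool × Fin n × Fin n)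
    (b : Finset (Fin n)) (hSb : S ⊆ b) (hS'b : Disjoint S' b) :
    psi S S' t ⬝ᵥ udPt b = psi S S' t ⬝ᵥ udPt S := by
  have key : ∀ p ∈ S ∪ S', udInd b p = udInd S p := by
    intro p hp
    rw [udInd_apply, udInd_apply]
    rcases Finset.mem_union.1 hp with h | h
    · rw [if_pos (hSb h), if_pos h]
    · rw [if_neg (Finset.disjoint_left.1 hS'b h), if_neg (Finset.disjoint_left.1 hSS'.symm h)]
  have h01 : ∀ (c : Finset (Fin n)) (i : Fin n), udInd c i = 0 ∨ udInd c i = 1 := by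
    intro c i; rw [udInd_apply]; by_cases h : i ∈ c <;> simp [h]
  obtain ⟨c, p, q⟩ := t
  cases c
  · simp only [psi]
    split_ifs with h
    · rw [ent_dot_udPt, ent_dot_udPt, key p h.1, key q h.2]
    · simp
  · simp only [psi]
    split_ifs with hk hp hp'
    · simp
    · rw [sub_dotProduct, sub_dotProduct, ent_dot_udPt, ent_dot_udPt, ent_dot_udPt, ent_dot_udPt,
        key p (Finset.mem_union_left _ hp)]
      have hqS : udInd S q = 0 := by
        rw [udInd_apply, if_neg (fun h => hk (Finset.mem_union_left _ h))]
      have hpS : udInd S p = 1 := by rw [udInd_apply, if_pos hp]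
      rw [hqS, hpS]
      rcases h01 b q with h | h <;> rw [h] <;> ring
    · rw [ent_dot_udPt, ent_dot_udPt, key p (Finset.mem_union_right _ hp')]
      have hpS : udInd S p = 0 := by
        rw [udInd_apply, if_neg (Finset.disjoint_left.1 hSS'.symm hp')]
      rw [hpS]; ring
    · simp

/-! ## §3 The EXPOSURE RUNG -/

/-- ★ **EXPOSURE RUNG.**  If `COR(n) + Q` has an extended formulation of size `r`, `Q = conv{q j}` (up to the usual
sandwich), `S, S'` are disjoint with `m` indices `e` outside both, and NO TWO DISTINCT generators `q j ≠ q j'` differ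
by a vector annihilated by every test functional of the face `F_{S,S'}` (i.e. by a solution of the face's linear
equations), then `3^m ≤ (r + 1) · 2^m`: a generic functional `M·(E_S - E_{S'}) + Σ_t ε_t ψ_t` in the normal cone of
`F_{S,S'}` exposes `F_{S,S'} + {q_{j₀}}`, and FMPTW/Kaibel–Weltge applies to the face (PROP B with ONE maximiser, for
every passenger transversal to the face). -/
theorem corPolytope_add_genericFace_three_pow_le {n m r : ℕ} {Q : Set (Fin (n * n) → ℝ)}
    (h : HasEFOfSize (corPolytope n + Q) r) {J : Type} [Fintype J] [Nonempty J] [DecidableEq J]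
    (q : J → (Fin (n * n) → ℝ)) (hq : ∀ j, q j ∈ Q) (hQ : Q ⊆ convexHull ℝ (Set.range q))
    (S S' : Finset (Fin n)) (hSS' : Disjoint S S') (e : Fin m ↪ Fin n) (heS : ∀ i, e i ∉ S)
    (heS' : ∀ i, e i ∉ S')
    (hsep : ∀ j j', (∀ t, psi S S' t ⬝ᵥ (q j - q j') = 0) → q j = q j') :
    3 ^ m ≤ (r + 1) * 2 ^ m := by
  classical
  obtain ⟨pt_mem, cc_valid, slack, diag_pt⟩ := ud_data n
  -- (1) a generic combination of the tests
  let BAD : Finset (J × J) := Finset.univ.filter fun jj => q jj.1 ≠ q jj.2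
  obtain ⟨ε, hε⟩ := exists_generic_comb (K := Bool × Fin n × Fin n) BAD
    (fun t (jj : J × J) => psi S S' t ⬝ᵥ (q jj.1 - q jj.2))
  let ev : Fin (n * n) → ℝ := ∑ t, ε t • psi S S' t
  have hev : ∀ x, ev ⬝ᵥ x = ∑ t, ε t * (psi S S' t ⬝ᵥ x) := by
    intro x
    simp only [ev, sum_dotProduct, smul_dotProduct, smul_eq_mul]
  -- (2) the dominant diagonal part, avoiding the remaining coincidences
  have hpairs : ∀ p ∈ BAD.image (fun jj => (diagDir S S' ⬝ᵥ (q jj.1 - q jj.2), ev ⬝ᵥ (q jj.1 - q jj.2))),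
      p.1 ≠ 0 ∨ p.2 ≠ 0 := by
    intro p hp
    obtain ⟨jj, hjj, rfl⟩ := Finset.mem_image.1 hp
    by_contra hcon
    push Not at hcon
    have hbad : q jj.1 ≠ q jj.2 := (Finset.mem_filter.1 hjj).2
    apply hbad
    apply hsep
    intro t
    by_contra ht
    have hne := hε jj hjj ⟨t, ht⟩
    rw [← hev] at hne
    exact hne hcon.2
  obtain ⟨M, hMC, hM⟩ := exists_large_avoid _ hpairs (2 * ∑ t, |ε t|)
  set w : Fin (n * n) → ℝ := M • diagDir S S' + ev with hw
  have hwdot : ∀ x, w ⬝ᵥ x = M * (diagDir S S' ⬝ᵥ x) + ev ⬝ᵥ x := by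
    intro x; rw [hw, add_dotProduct, smul_dotProduct, smul_eq_mul]
  -- `w` separates distinct generators
  have hwsep : ∀ j j', q j ≠ q j' → w ⬝ᵥ q j ≠ w ⬝ᵥ q j' := by
    intro j j' hne heq
    have hmem : (diagDir S S' ⬝ᵥ (q j - q j'), ev ⬝ᵥ (q j - q j')) ∈
        BAD.image (fun jj => (diagDir S S' ⬝ᵥ (q jj.1 - q jj.2), ev ⬝ᵥ (q jj.1 - q jj.2))) :=
      Finset.mem_image.2 ⟨(j, j'), Finset.mem_filter.2 ⟨Finset.mem_univ _, hne⟩, rfl⟩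
    have hne' := hM _ hmem
    apply hne'
    show diagDir S S' ⬝ᵥ (q j - q j') * M + ev ⬝ᵥ (q j - q j') = 0
    have h1 : w ⬝ᵥ (q j - q j') = 0 := by rw [dotProduct_sub, heq, sub_self]
    rw [hwdot] at h1
    linarith
  -- (3) values on the vertices of `COR(n)`
  have hdiag : ∀ b : Finset (Fin n),
      diagDir S S' ⬝ᵥ udPt b = ((S ∩ b).card : ℝ) - ((S' ∩ b).card : ℝ) := by
    intro b
    rw [diagDir, diag_pt]
    have hσ : ∀ i, (if i ∈ S then (1 : ℝ) else if i ∈ S' then -1 else 0) =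
        (if i ∈ S then (1 : ℝ) else 0) - (if i ∈ S' then 1 else 0) := by
      intro i
      by_cases h1 : i ∈ S
      · have h2 : i ∉ S' := Finset.disjoint_left.1 hSS' h1
        simp [h1, h2]
      · by_cases h2 : i ∈ S' <;> simp [h1, h2]
    simp_rw [hσ]
    rw [Finset.sum_sub_distrib, Finset.sum_boole, Finset.sum_boole, Finset.filter_mem_eq_inter,
      Finset.filter_mem_eq_inter, Finset.inter_comm b S, Finset.inter_comm b S']
  have hdiag_face : ∀ b : Finset (Fin n), S ⊆ b → Disjoint S' b →
      diagDir S S' ⬝ᵥ udPt b = S.card := by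
    intro b hSb hS'b
    rw [hdiag b, Finset.inter_eq_left.2 hSb, Finset.disjoint_iff_inter_eq_empty.1 hS'b,
      Finset.card_empty]
    simp
  have hdiag_off : ∀ b : Finset (Fin n), ¬ (S ⊆ b ∧ Disjoint S' b) →
      diagDir S S' ⬝ᵥ udPt b ≤ S.card - 1 := by
    intro b hb
    rw [hdiag b]
    by_cases hSb : S ⊆ b
    · have hS'b : ¬ Disjoint S' b := fun h' => hb ⟨hSb, h'⟩
      obtain ⟨i, hi⟩ := Finset.not_disjoint_iff_nonempty_inter.1 hS'b
      have h2 : (1 : ℝ) ≤ (S' ∩ b).card := by exact_mod_cast Finset.card_pos.2 ⟨i, hi⟩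
      have h1 : ((S ∩ b).card : ℝ) ≤ S.card := by
        exact_mod_cast Finset.card_le_card Finset.inter_subset_left
      linarith
    · have hlt : (S ∩ b).card < S.card := by
        apply Finset.card_lt_card
        refine ⟨Finset.inter_subset_left, fun hsub => hSb ?_⟩
        exact fun i hi => (Finset.mem_inter.1 (hsub hi)).2
      have h1 : ((S ∩ b).card : ℝ) + 1 ≤ S.card := by exact_mod_cast hlt
      have h2 : (0 : ℝ) ≤ (S' ∩ b).card := by positivity
      linarith
  have hev_le : ∀ b : Finset (Fin n), |ev ⬝ᵥ udPt b| ≤ ∑ t, |ε t| := by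
    intro b
    rw [hev]
    refine (Finset.abs_sum_le_sum_abs _ _).trans ?_
    refine Finset.sum_le_sum fun t _ => ?_
    rw [abs_mul]
    exact mul_le_of_le_one_right (abs_nonneg _) (psi_abs_le S S' t b)
  have hev_face : ∀ b : Finset (Fin n), S ⊆ b → Disjoint S' b → ev ⬝ᵥ udPt b = ev ⬝ᵥ udPt S := by
    intro b hSb hS'b
    rw [hev, hev]
    exact Finset.sum_congr rfl fun t _ => by rw [psi_face S S' hSS' t b hSb hS'b]
  set δP : ℝ := M * S.card + ev ⬝ᵥ udPt S with hδP
  have hMpos : 0 ≤ M := by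
    have : (0 : ℝ) ≤ 2 * ∑ t, |ε t| := by positivity
    linarith
  have hw_vert : ∀ b : Finset (Fin n), w ⬝ᵥ udPt b ≤ δP := by
    intro b
    rw [hwdot]
    by_cases hb : S ⊆ b ∧ Disjoint S' b
    · rw [hdiag_face b hb.1 hb.2, hev_face b hb.1 hb.2]
    · have h1 := hdiag_off b hb
      have h2 := hev_le b
      have h3 := hev_le S
      rw [abs_le] at h2 h3
      have h4 : M * (diagDir S S' ⬝ᵥ udPt b) ≤ M * ((S.card : ℝ) - 1) :=
        mul_le_mul_of_nonneg_left h1 hMpos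
      linarith [h2.2, h3.1]
  have hw_face : ∀ b : Finset (Fin n), S ⊆ b → Disjoint S' b → w ⬝ᵥ udPt b = δP := by
    intro b hSb hS'b
    rw [hwdot, hdiag_face b hSb hS'b, hev_face b hSb hS'b]
  -- validity of `w` on `COR(n)`
  have hgen : ∀ y ∈ Set.range (fun a : Cube n => vecOuter n (bvec a)), w ⬝ᵥ y ≤ δP := by
    rintro _ ⟨a, rfl⟩
    have hpt : vecOuter n (bvec a) = udPt (Finset.univ.filter fun i => a i = true) := by
      unfold udPt
      congr 1
      funext i
      rw [udInd_apply]
      simp [bvec]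
    show w ⬝ᵥ vecOuter n (bvec a) ≤ δP
    rw [hpt]
    exact hw_vert _
  have hwP : ∀ x ∈ corPolytope n, w ⬝ᵥ x ≤ δP := fun x hx =>
    dot_le_of_mem_convexHull _ w δP hgen x hx
  -- (4) the face of `Q`: a single point
  obtain ⟨j₀, -, hj₀⟩ :=
    Finset.exists_max_image Finset.univ (fun j => w ⬝ᵥ q j) Finset.univ_nonempty
  have hmax : ∀ j, w ⬝ᵥ q j ≤ w ⬝ᵥ q j₀ := fun j => hj₀ j (Finset.mem_univ j)
  set δQ := w ⬝ᵥ q j₀ with hδQ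
  have hwQ : ∀ y ∈ Q, w ⬝ᵥ y ≤ δQ := fun y hy =>
    dot_le_of_mem_convexHull _ w δQ (by rintro _ ⟨j, rfl⟩; exact hmax j) y (hQ hy)
  have hFG := hasEFOfSize_face_add h w δP δQ hwP hwQ
  have hmaxpt : ∀ j, w ⬝ᵥ q j = δQ → q j = q j₀ := by
    intro j hj
    by_contra hne
    exact hwsep j j₀ hne (by rw [hj])
  have hQface : Q ∩ {y | w ⬝ᵥ y = δQ} ⊆ convexHull ℝ (Set.range fun _ : Fin 1 => q j₀) := by
    rintro y ⟨hy, hyw⟩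
    have hy' := mem_convexHull_maximisers q w δQ hmax (hQ hy) hyw
    have hsub : Set.range (fun j : {j : J // w ⬝ᵥ q j = δQ} => q j.1) ⊆ {q j₀} := by
      rintro _ ⟨j, rfl⟩; exact hmaxpt j.1 j.2
    have hy1 : y ∈ convexHull ℝ ({q j₀} : Set (Fin (n * n) → ℝ)) := convexHull_mono hsub hy'
    rw [convexHull_singleton] at hy1
    rw [Set.mem_singleton_iff.1 hy1]
    exact subset_convexHull ℝ _ ⟨0, rfl⟩
  -- (5) the unique-disjointness data of the face, indexed by subsets of `Fin m` (as in PROP B)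
  let B : Finset (Fin m) → Finset (Fin n) := fun b' => S ∪ b'.map e
  let A : Finset (Fin m) → Finset (Fin n) := fun a' => a'.map e
  have hAB : ∀ a' b', (A a' ∩ B b').card = (a' ∩ b').card := by
    intro a' b'
    have h1 : A a' ∩ B b' = (a' ∩ b').map e := by
      ext i
      simp only [A, B, Finset.mem_inter, Finset.mem_union, Finset.mem_map]
      constructor
      · rintro ⟨⟨x, hx, rfl⟩, h2 | ⟨y, hy, hxy⟩⟩
        · exact absurd h2 (heS x)
        · have hyx : y = x := e.injective hxy
          subst hyx
          exact ⟨y, ⟨hx, hy⟩, rfl⟩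
      · rintro ⟨x, ⟨hxa, hxb⟩, rfl⟩
        exact ⟨⟨x, hxa, rfl⟩, Or.inr ⟨x, hxb, rfl⟩⟩
    rw [h1, Finset.card_map]
  have hBface : ∀ b', S ⊆ B b' ∧ Disjoint S' (B b') := by
    intro b'
    refine ⟨Finset.subset_union_left, ?_⟩
    rw [Finset.disjoint_union_right]
    refine ⟨hSS'.symm, ?_⟩
    rw [Finset.disjoint_left]
    intro i hiS' hi
    obtain ⟨x, -, rfl⟩ := Finset.mem_map.1 hi
    exact heS' x hiS'
  have key := three_pow_le_of_add (α := Fin m) hFG (fun b' => udPt (B b'))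
    (fun b' => ⟨pt_mem _, hw_face _ (hBface b').1 (hBface b').2⟩) (fun a' => udRow (A a'))
    (fun _ => 1) (fun a' x hx => cc_valid (A a') x hx.1) ?_ ?_
    (fun _ : Fin 1 => q j₀) (fun _ => ⟨hq j₀, rfl⟩) hQface
  · simpa [Fintype.card_fin] using key
  · intro a' b' hlt hone
    have := slack (A a') (B b')
    rw [hAB, hone] at this
    norm_num at this
    linarith
  · intro a' b' hab
    have := slack (A a') (B b')
    rw [hAB, Finset.disjoint_iff_inter_eq_empty.1 hab, Finset.card_empty] at this
    norm_num at this
    linarith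


/-! ## §4 The FLAG LEMMA and the DIMENSION RUNG (unconditional) -/

/-- the solution space of the face equations of `F_{A,∅}`: `K_A := {x | ψ_t · x = 0 for every test t of (A, ∅)}`. -/
def faceKer (A : Finset (Fin n)) : Submodule ℝ (Fin (n * n) → ℝ) where
  carrier := {x | ∀ t, psi A ∅ t ⬝ᵥ x = 0}
  add_mem' := by
    intro x y hx hy t
    show psi A ∅ t ⬝ᵥ (x + y) = 0
    rw [dotProduct_add, hx t, hy t, add_zero]
  zero_mem' := by
    intro t
    show psi A ∅ t ⬝ᵥ 0 = 0
    rw [dotProduct_zero]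
  smul_mem' := by
    intro c x hx t
    show psi A ∅ t ⬝ᵥ (c • x) = 0
    rw [dotProduct_smul, hx t, smul_zero]

theorem mem_faceKer {A : Finset (Fin n)} {x : Fin (n * n) → ℝ} :
    x ∈ faceKer A ↔ ∀ t, psi A ∅ t ⬝ᵥ x = 0 := Iff.rfl

/-- what the face equations say entrywise: zero on `A × A`, and row `p ∈ A` coupled to the diagonal off `A`. -/
theorem faceKer_prop {A : Finset (Fin n)} {x : Fin (n * n) → ℝ} (hx : x ∈ faceKer A) :
    (∀ p ∈ A, ∀ q ∈ A, x (finProdFinEquiv (p, q)) = 0) ∧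
    (∀ p ∈ A, ∀ k ∉ A, x (finProdFinEquiv (p, k)) = x (finProdFinEquiv (k, k))) := by
  rw [mem_faceKer] at hx
  constructor
  · intro p hp q hq
    have h1 := hx (false, p, q)
    have hcond : p ∈ A ∪ ∅ ∧ q ∈ A ∪ ∅ := by simp [hp, hq]
    simp only [psi] at h1
    rw [if_pos hcond, ent_dot] at h1
    exact h1
  · intro p hp k hk
    have h1 := hx (true, p, k)
    have hk' : k ∉ A ∪ ∅ := by simpa using hk
    simp only [psi] at h1
    rw [if_neg hk', if_pos hp, sub_dotProduct, ent_dot, ent_dot] at h1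
    linarith

/-- ★ **FLAG LEMMA (PROVED):** a vector annihilated by the face equations of `F_{A ∪ {j}, ∅}` for EVERY `j ∉ A`
(`A ≠ univ`) is zero — so inside any nonzero direction space some one-index extension of the flag cuts the kernel. -/
theorem faceKer_flag {A : Finset (Fin n)} {x : Fin (n * n) → ℝ} (hA : A ≠ Finset.univ)
    (hx : ∀ j ∉ A, x ∈ faceKer (insert j A)) : x = 0 := by
  classical
  obtain ⟨j₀, hj₀⟩ : ∃ j, j ∉ A := by
    by_contra hcon
    push Not at hcon
    exact hA (Finset.eq_univ_of_forall hcon)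
  funext i
  obtain ⟨⟨p, q⟩, rfl⟩ := finProdFinEquiv.surjective i
  show x (finProdFinEquiv (p, q)) = 0
  by_cases hp : p ∈ A
  · by_cases hq : q ∈ A
    · exact (faceKer_prop (hx j₀ hj₀)).1 p (Finset.mem_insert_of_mem hp) q (Finset.mem_insert_of_mem hq)
    · exact (faceKer_prop (hx q hq)).1 p (Finset.mem_insert_of_mem hp) q (Finset.mem_insert_self q A)
  · by_cases hq : q ∈ A
    · exact (faceKer_prop (hx p hp)).1 p (Finset.mem_insert_self p A) q (Finset.mem_insert_of_mem hq)
    · by_cases hpq : p = q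
      · subst hpq
        exact (faceKer_prop (hx p hp)).1 p (Finset.mem_insert_self p A) p (Finset.mem_insert_self p A)
      · have h1 := (faceKer_prop (hx p hp)).2 p (Finset.mem_insert_self p A) q
          (by rw [Finset.mem_insert]; push Not; exact ⟨fun h => hpq h.symm, hq⟩)
        have h2 := (faceKer_prop (hx q hq)).1 q (Finset.mem_insert_self q A) q
          (Finset.mem_insert_self q A)
        rw [h1, h2]

theorem faceKer_mono {A A' : Finset (Fin n)} (hAA' : A ⊆ A') : faceKer A' ≤ faceKer A := by
  intro x hx
  have hP := faceKer_prop hx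
  rw [mem_faceKer]
  intro t
  obtain ⟨c, p, q⟩ := t
  cases c
  · simp only [psi]
    split_ifs with h
    · rw [ent_dot]
      simp only [Finset.union_empty] at h
      exact hP.1 p (hAA' h.1) q (hAA' h.2)
    · simp
  · simp only [psi]
    split_ifs with hk hp hp'
    · simp
    · rw [sub_dotProduct, ent_dot, ent_dot]
      simp only [Finset.union_empty] at hk
      by_cases hkA' : q ∈ A'
      · rw [hP.1 p (hAA' hp) q hkA', hP.1 q hkA' q hkA', sub_zero]
      · rw [hP.2 p (hAA' hp) q hkA', sub_self]
    · simp at hp'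
    · simp

theorem faceKer_univ : faceKer (Finset.univ : Finset (Fin n)) = ⊥ := by
  rw [Submodule.eq_bot_iff]
  intro x hx
  funext i
  obtain ⟨⟨p, q⟩, rfl⟩ := finProdFinEquiv.surjective i
  exact (faceKer_prop hx).1 p (Finset.mem_univ p) q (Finset.mem_univ q)

theorem faceKer_flagStep {A : Finset (Fin n)} (V : Submodule ℝ (Fin (n * n) → ℝ))
    (hA : A ≠ Finset.univ) (hV : V ≠ ⊥) : ∃ j ∉ A, ¬ (V ≤ faceKer (insert j A)) := by
  by_contra hcon
  push Not at hcon
  apply hV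
  rw [Submodule.eq_bot_iff]
  intro x hx
  exact faceKer_flag hA (fun j hj => hcon j hj hx)

/-- the flag, iterated: `dim (V ⊓ K_A)` more prescribed indices kill `V ⊓ K`. -/
theorem faceKer_flag_iterate (V : Submodule ℝ (Fin (n * n) → ℝ)) :
    ∀ (k : ℕ) (A : Finset (Fin n)), Module.finrank ℝ ↥(V ⊓ faceKer A) ≤ k →
      ∃ A' : Finset (Fin n), A'.card ≤ A.card + k ∧ V ⊓ faceKer A' = ⊥ := by
  intro k
  induction k with
  | zero =>
    intro A hA
    exact ⟨A, by simp, Submodule.finrank_eq_zero.1 (Nat.le_zero.1 hA)⟩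
  | succ k ih =>
    intro A hA
    by_cases hbot : V ⊓ faceKer A = ⊥
    · exact ⟨A, by simp, hbot⟩
    · have hAu : A ≠ Finset.univ := by
        rintro rfl
        exact hbot (by rw [faceKer_univ]; simp)
      obtain ⟨j, hj, hnot⟩ := faceKer_flagStep (V ⊓ faceKer A) hAu hbot
      have hle : V ⊓ faceKer (insert j A) ≤ V ⊓ faceKer A :=
        inf_le_inf_left _ (faceKer_mono (Finset.subset_insert j A))
      have hlt : V ⊓ faceKer (insert j A) < V ⊓ faceKer A := by
        refine lt_of_le_of_ne hle ?_
        intro heq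
        apply hnot
        rw [← heq]
        exact inf_le_right
      have hrank := Submodule.finrank_lt_finrank_of_lt hlt
      obtain ⟨A', hcard, hA'⟩ := ih (insert j A) (by omega)
      refine ⟨A', ?_, hA'⟩
      have := Finset.card_insert_le j A
      omega

theorem three_two_descend {m m' R : ℕ} (hmm : m ≤ m') (H : 3 ^ m' ≤ R * 2 ^ m') :
    3 ^ m ≤ R * 2 ^ m := by
  obtain ⟨k, rfl⟩ := Nat.exists_eq_add_of_le hmm
  have h2 : 0 < 2 ^ k := by positivity
  have key : 3 ^ m * 2 ^ k ≤ R * 2 ^ m * 2 ^ k :=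
    calc 3 ^ m * 2 ^ k ≤ 3 ^ m * 3 ^ k :=
          Nat.mul_le_mul_left _ (Nat.pow_le_pow_left (by norm_num) k)
      _ = 3 ^ (m + k) := (pow_add 3 m k).symm
      _ ≤ R * 2 ^ (m + k) := H
      _ = R * 2 ^ m * 2 ^ k := by rw [pow_add, mul_assoc]
  exact Nat.le_of_mul_le_mul_right key h2

/-- ★★ **DIMENSION RUNG (PROVED, unconditional, Q-uniform):** for EVERY finite generating family `q` —
no genericity, no vertex count, no sign pattern — an extended formulation of `COR(n) + conv{q j}` of size `r` forces
`3^{n-d} ≤ (r+1)·2^{n-d}`, `d = dim (aff {q j})`; i.e. `xc(COR(n) + Q) ≥ 1.5^{n - dim Q} - 1`.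
(`d = 0`: FMPTW/Kaibel–Weltge; `d < (1-ε)n`: still `2^{Ω(n)}`; the SURVIVORS of the lens are exactly the passengers
whose direction space needs `≥ (1-ε)n` flag indices to be cut — fan-saturating zonotopes `Z_h`, dense towers.) -/
theorem corPolytope_add_three_pow_le_of_finrank {n r : ℕ} {J : Type} [Fintype J] [Nonempty J] [DecidableEq J]
    (q : J → (Fin (n * n) → ℝ))
    (h : HasEFOfSize (corPolytope n + convexHull ℝ (Set.range q)) r) :
    3 ^ (n - Module.finrank ℝ ↥(vectorSpan ℝ (Set.range q))) ≤
      (r + 1) * 2 ^ (n - Module.finrank ℝ ↥(vectorSpan ℝ (Set.range q))) := by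
  classical
  obtain ⟨A', hcard, hA'⟩ := faceKer_flag_iterate (vectorSpan ℝ (Set.range q))
    (Module.finrank ℝ ↥(vectorSpan ℝ (Set.range q))) ∅ (Submodule.finrank_mono inf_le_left)
  have hsep : ∀ j j', (∀ t, psi A' ∅ t ⬝ᵥ (q j - q j') = 0) → q j = q j' := by
    intro j j' ht
    have hK : q j - q j' ∈ faceKer A' := ht
    have hV : q j - q j' ∈ vectorSpan ℝ (Set.range q) := by
      have := vsub_mem_vectorSpan ℝ (Set.mem_range_self (f := q) j) (Set.mem_range_self (f := q) j')
      rwa [vsub_eq_sub] at this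
    have hmem' : q j - q j' ∈ vectorSpan ℝ (Set.range q) ⊓ faceKer A' := ⟨hV, hK⟩
    rw [hA', Submodule.mem_bot] at hmem'
    exact sub_eq_zero.1 hmem'
  have hR : (A'ᶜ).card = n - A'.card := by rw [Finset.card_compl, Fintype.card_fin]
  let e : Fin (n - A'.card) ↪ Fin n := ((A'ᶜ).orderEmbOfFin hR).toEmbedding
  have he : ∀ i, e i ∉ A' := fun i => Finset.mem_compl.1 (Finset.orderEmbOfFin_mem _ hR i)
  have hrung := corPolytope_add_genericFace_three_pow_le h q
    (fun j => subset_convexHull ℝ _ (Set.mem_range_self j)) subset_rfl A' ∅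
    (Finset.disjoint_empty_right A') e he (fun i => by simp) hsep
  simp only [Finset.card_empty, zero_add] at hcard
  exact three_two_descend (by omega) hrung


/-- ★★ **DIMENSION RUNG in the route's graph currency `COR(K_h) = corPolytopeGraph ⊤`** (the currency of
`CorMinkowskiHard`, of AFHMS's located clique face and of `transport_geometric`): for every finite family `q`,
`3^{h-d} ≤ (r+1)·2^{h-d}` with `d = dim (aff {q j})`.  With `J = Fin (K+1)` this is literally `CorMinkowskiHard`'s
hypothesis ⇒ `r + 1 ≥ 1.5^{h - dim Q}`: COR-MINKOWSKI holds for every passenger of dimension `≤ (1-ε)h`. -/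
theorem corPolytopeGraph_top_add_hull_three_pow_le_of_finrank {h r : ℕ} {J : Type} [Fintype J] [Nonempty J]
    [DecidableEq J] (q : J → (Fin h × Fin h → ℝ))
    (hyp : HasEFOfSize (corPolytopeGraph (⊤ : SimpleGraph (Fin h)) + convexHull ℝ (Set.range q)) r) :
    3 ^ (h - Module.finrank ℝ ↥(vectorSpan ℝ (Set.range q))) ≤
      (r + 1) * 2 ^ (h - Module.finrank ℝ ↥(vectorSpan ℝ (Set.range q))) := by
  let e : (Fin h × Fin h → ℝ) ≃ₗ[ℝ] (Fin (h * h) → ℝ) :=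
    LinearEquiv.funCongrLeft ℝ ℝ (finProdFinEquiv (m := h) (n := h)).symm
  have himg : e '' (corPolytopeGraph (⊤ : SimpleGraph (Fin h)) + convexHull ℝ (Set.range q)) =
      corPolytope h + convexHull ℝ (Set.range (e ∘ q)) := by
    rw [Set.image_add, Literature.Barriers.PneNP.corPolytope_eq_image_corPolytopeGraph_top, Set.range_comp]
    congr 1
    exact e.toLinearMap.image_convexHull (Set.range q)
  have h' : HasEFOfSize (corPolytope h + convexHull ℝ (Set.range (e ∘ q))) r := by
    rw [← himg]; exact (HasEFOfSize.image_linearEquiv_iff e).2 hyp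
  have hdim : Module.finrank ℝ ↥(vectorSpan ℝ (Set.range (e ∘ q))) =
      Module.finrank ℝ ↥(vectorSpan ℝ (Set.range q)) := by
    rw [Set.range_comp]
    have hvs : vectorSpan ℝ (e '' Set.range q) =
        (vectorSpan ℝ (Set.range q)).map (e : (Fin h × Fin h → ℝ) →ₗ[ℝ] (Fin (h * h) → ℝ)) := by
      have := AffineMap.vectorSpan_image_eq_submodule_map (e.toLinearMap.toAffineMap) (s := Set.range q)
      simpa using this.symm
    rw [hvs]
    exact LinearEquiv.finrank_map_eq e _
  have := corPolytope_add_three_pow_le_of_finrank (e ∘ q) h'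
  rwa [hdim] at this


/-! ## §5 The transport WITH the passenger's dimension, and the NN-currency corollary
(VERDICT #8's P2): an extended formulation of `Newt(NN_n) + Newt(g)` yields one of `COR(K_h) + conv{q}` with
`dim aff {q} ≤ dim aff supp(g)` — the passenger is a linear image of a face of `Newt(g)` — so the DIMENSION RUNG
decides every cofactor `g ≠ 0` whose support spans an affine space of dimension `< (1-ε)·h`, `h = Θ(√n)` the clique
order of the located face: a cofactor class defined by NO degree / sign / vertex-count condition. -/

section Transport

open MvPolynomial
open scoped NNReal
open Literature.Computability.AlgebraicComplexity (complexity nestFreeMatchingPoly)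
open Literature.Computability.AlgebraicComplexity.MonotoneCircuitEF (hasEFOfSize_newtonPolytope_complexity)
open Literature.Algebra.Polynomial.NewtonPolytope (newtonPolytope newtonPolytope_mul)
open Summit.ValiantsHypothesis.ValiantsHypothesis.Theorems.FifoMatching.QueueGridFace
  (realOf suppPts newt QGV patternVec queueGridPP corMap corMap_image_queueGridPP newt_nonneg)
open Summit.ValiantsHypothesis.ValiantsHypothesis.Theorems.FifoMatching.GridCorShadow (queueGridZeroOnePoints_holds)
open Summit.ValiantsHypothesis.ValiantsHypothesis.Theorems.FifoMatching.MonomialCofactor (newt_eq_newtonPolytope)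
open Literature.Combinatorics.Optimization (AboulkerEtAl2019_gridCorCliqueFace)

/-- the affine dimension of a point set, as the rank of its direction space. -/
noncomputable abbrev adim {ι : Type} (S : Set (ι → ℝ)) : ℕ := Module.finrank ℝ ↥(vectorSpan ℝ S)

theorem adim_image_le {ι κ : Type} [Fintype ι] [Fintype κ] (L : (ι → ℝ) →ₗ[ℝ] (κ → ℝ)) (S : Set (ι → ℝ)) :
    adim (L '' S) ≤ adim S := by
  unfold adim
  have hvs : vectorSpan ℝ (L '' S) = (vectorSpan ℝ S).map L := by
    have := AffineMap.vectorSpan_image_eq_submodule_map L.toAffineMap (s := S)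
    simpa using this.symm
  rw [hvs]
  exact Submodule.finrank_map_le L _

theorem adim_mono {ι : Type} [Fintype ι] {S T : Set (ι → ℝ)} (h : S ⊆ T) : adim S ≤ adim T :=
  Submodule.finrank_mono (vectorSpan_mono ℝ h)

/-- **ONE TRANSPORT STEP, with dimension**: as `transport_step`, and the new passenger (the `L`-image of a face of
`conv{q j}`) has affine dimension at most that of `{q j}`. -/
theorem transport_step_dim {ι κ J : Type} [Fintype ι] [Fintype κ] [Fintype J] [Nonempty J]
    {P : Set (ι → ℝ)} (q : J → ι → ℝ) {r : ℕ} (h : HasEFOfSize (P + convexHull ℝ (Set.range q)) r)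
    (w : ι → ℝ) (δ : ℝ) (hP : ∀ x ∈ P, w ⬝ᵥ x ≤ δ) (L : (ι → ℝ) →ₗ[ℝ] (κ → ℝ)) :
    ∃ (K : ℕ) (q' : Fin (K + 1) → κ → ℝ),
      HasEFOfSize (L '' (P ∩ {x | w ⬝ᵥ x = δ}) + convexHull ℝ (Set.range q')) r ∧
        adim (Set.range q') ≤ adim (Set.range q) := by
  classical
  obtain ⟨j₀, -, hj₀⟩ :=
    Finset.exists_max_image Finset.univ (fun j => w ⬝ᵥ q j) Finset.univ_nonempty
  have hle : ∀ j, w ⬝ᵥ q j ≤ w ⬝ᵥ q j₀ := fun j => hj₀ j (Finset.mem_univ _)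
  have hQ : ∀ y ∈ convexHull ℝ (Set.range q), w ⬝ᵥ y ≤ w ⬝ᵥ q j₀ :=
    dot_le_of_mem_convexHull _ w _ (by rintro _ ⟨j, rfl⟩; exact hle j)
  have h2 := hasEFOfSize_image_add (hasEFOfSize_face_add h w δ _ hP hQ) L
  rw [convexHull_range_inter_eq q w _ hle, LinearMap.image_convexHull, ← Set.range_comp] at h2
  haveI : Nonempty {j : J // w ⬝ᵥ q j = w ⬝ᵥ q j₀} := ⟨⟨j₀, rfl⟩⟩
  obtain ⟨K, q', hq'⟩ := exists_fin_range_eq (L ∘ fun j : {j : J // w ⬝ᵥ q j = w ⬝ᵥ q j₀} => q j.1)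
  refine ⟨K, q', by rw [hq']; exact h2, ?_⟩
  have hsub : Set.range q' ⊆ L '' Set.range q := by
    rw [hq', Set.range_comp]
    exact Set.image_mono (by rintro _ ⟨j, rfl⟩; exact ⟨j.1, rfl⟩)
  exact (adim_mono hsub).trans (adim_image_le L _)

/-- **THE GEOMETRIC TRANSPORT WITH DIMENSION (PROVED)**: as `transport_geometric`, and the transported passenger
has affine dimension at most `dim aff supp(g)` of the cofactor `g`. -/
theorem transport_geometric_dim :
    ∃ c : ℝ, 0 < c ∧ ∃ t₀ : ℕ, ∀ (n r g : ℕ), 1 ≤ r → (r + 1) * (2 * r + 1) ≤ n → ∀ (hg : 2 * g ≤ r), t₀ ≤ g →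
      ∀ (hh : MvPolynomial (Fin (2 * n) × Fin (2 * n)) ℝ≥0), hh ≠ 0 → ∀ s : ℕ,
        HasEFOfSize (newtR (nestFreeMatchingPoly n ℝ≥0) + newtR hh) s →
          ∃ h : ℕ, c * g ≤ h ∧ ∃ (K : ℕ) (q : Fin (K + 1) → (Fin h × Fin h → ℝ)),
            HasEFOfSize (corPolytopeGraph (⊤ : SimpleGraph (Fin h)) + convexHull ℝ (Set.range q)) s ∧
              adim (Set.range q) ≤ adim (suppPts hh) := by
  classical
  obtain ⟨c, hc, t₀, hface⟩ := AboulkerEtAl2019_gridCorCliqueFace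
  refine ⟨c, hc, t₀, fun n r g hr hn hg ht hh hh0 s hEF => ?_⟩
  have hEF' : HasEFOfSize (newt (nestFreeMatchingPoly n ℝ≥0) + newt hh) s := by
    rw [newt_eq_newtonPolytope, newt_eq_newtonPolytope]; exact hEF
  haveI : Nonempty hh.support := (MvPolynomial.support_nonempty.2 hh0).coe_sort
  let q₀ : hh.support → (Fin (2 * n) × Fin (2 * n)) → ℝ := fun d => realOf d.1
  have hS : suppPts hh = Set.range q₀ := by
    unfold suppPts; rw [Set.image_eq_range]; rfl
  have hQ : newt hh = convexHull ℝ (Set.range q₀) := by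
    unfold newt; rw [hS]
  rw [hQ] at hEF'
  -- Step 1: the A1 coordinate face, read out onto `PP_r`
  obtain ⟨Z, f, hA1⟩ := queueGridZeroOnePoints_holds r n hr hn
  let w : (Fin (2 * n) × Fin (2 * n)) → ℝ := fun e => if e ∈ Z then (-1 : ℝ) else 0
  have hw : ∀ x : (Fin (2 * n) × Fin (2 * n)) → ℝ, w ⬝ᵥ x = -∑ e ∈ Z, x e := by
    intro x
    simp only [dotProduct, w, ite_mul, neg_one_mul, zero_mul]
    rw [Finset.sum_ite_mem, Finset.univ_inter, Finset.sum_neg_distrib]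
  have hP : ∀ x ∈ newt (nestFreeMatchingPoly n ℝ≥0), w ⬝ᵥ x ≤ 0 := fun x hx => by
    rw [hw]; exact neg_nonpos.2 (Finset.sum_nonneg fun e _ => newt_nonneg _ x hx e)
  let Lf : ((Fin (2 * n) × Fin (2 * n)) → ℝ) →ₗ[ℝ] ((QGV r × QGV r) × Bool × Bool → ℝ) :=
    LinearMap.funLeft ℝ ℝ f
  obtain ⟨K₁, q₁, h₁, hd₁⟩ := transport_step_dim q₀ hEF' w 0 hP Lf
  have hF : Lf '' (newt (nestFreeMatchingPoly n ℝ≥0) ∩ {x | w ⬝ᵥ x = 0}) = queueGridPP r := by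
    rw [newt_inter_zeroSet_eq, LinearMap.image_convexHull]
    unfold queueGridPP
    congr 1
  rw [hF] at h₁
  -- Step 2: c1's coordinate-linear map onto `COR(G_g)`
  have h₂ := hasEFOfSize_image_add h₁ (corMap r g hg)
  rw [corMap_image_queueGridPP, LinearMap.image_convexHull, ← Set.range_comp,
    ← Summit.ValiantsHypothesis.ValiantsHypothesis.Theorems.FifoMatching.QueueGridFace.corPolytopeGraph_eq] at h₂
  have hd₂ : adim (Set.range (⇑(corMap r g hg) ∘ q₁)) ≤ adim (Set.range q₁) := by
    rw [Set.range_comp]; exact adim_image_le _ _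
  -- Step 3: AFHMS's face of `COR(G_g)` onto `COR(K_h)`, as ONE valid functional
  obtain ⟨h, hch, k, cv, δ, π, hvalid, hπ⟩ := hface g ht
  obtain ⟨K₃, q₃, h₃, hd₃⟩ := transport_step_dim (⇑(corMap r g hg) ∘ q₁) h₂ (fun e => ∑ i, cv i e) (∑ i, δ i)
    (sum_dotProduct_le _ cv δ hvalid) π
  rw [← inter_forall_eq_inter_sum _ cv δ hvalid, hπ] at h₃
  refine ⟨h, hch, K₃, q₃, h₃, ?_⟩
  rw [hS]
  exact hd₃.trans (hd₂.trans hd₁)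

/-- ★★ **THE NN-CURRENCY COROLLARY (explicit form, PROVED):** with AFHMS's constants `c, t₀`: for `r ≥ 1`,
`n ≥ (r+1)(2r+1)`, `2g ≤ r`, `g ≥ t₀`, every cofactor `hh ≠ 0` and every size-`s` extended formulation of
`Newt(NN_n) + Newt(hh)`, there is `h ≥ c·g` with `3^{h - d} ≤ (s+1)·2^{h - d}`, `d = dim aff supp(hh)`.
Read: `xc(Newt(NN_n · hh)) + 1 ≥ 1.5^{c·g - dim aff supp(hh)}` — with `g = Θ(√n)`: every cofactor whose support
spans `< (1-ε)·c·√n/4` affine dimensions keeps `NN_n · hh` `2^{Ω(√n)}`-hard for monotone circuits, whatever its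
degrees, signs of nothing, number of monomials `≤ d + 1` NOT required (any number of monomials inside a
low-dimensional affine space). -/
theorem nn_cofactor_three_pow_le :
    ∃ c : ℝ, 0 < c ∧ ∃ t₀ : ℕ, ∀ (n r g : ℕ), 1 ≤ r → (r + 1) * (2 * r + 1) ≤ n → 2 * g ≤ r → t₀ ≤ g →
      ∀ (hh : MvPolynomial (Fin (2 * n) × Fin (2 * n)) ℝ≥0), hh ≠ 0 → ∀ s : ℕ,
        HasEFOfSize (newtR (nestFreeMatchingPoly n ℝ≥0) + newtR hh) s →
          ∃ h : ℕ, c * g ≤ h ∧ 3 ^ (h - adim (suppPts hh)) ≤ (s + 1) * 2 ^ (h - adim (suppPts hh)) := by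
  obtain ⟨c, hc, t₀, H⟩ := transport_geometric_dim
  refine ⟨c, hc, t₀, fun n r g hr hn hg ht hh hh0 s hEF => ?_⟩
  obtain ⟨h, hch, K, q, hq, hd⟩ := H n r g hr hn hg ht hh hh0 s hEF
  refine ⟨h, hch, ?_⟩
  have hrung := corPolytopeGraph_top_add_hull_three_pow_le_of_finrank q hq
  exact three_two_descend (by unfold adim at hd ⊢; omega) hrung

/-- ★★ **… and in the crux's own currency (monotone circuit size of `NN_n · hh`)**: `Newt(NN_n·hh) = Newt NN_n + Newt hh`
over `ℝ≥0` and `xc(Newt f) ≤ 3·L₊(f)`, so `3^{h-d} ≤ (3·L₊(NN_n·hh) + 1)·2^{h-d}` for some `h ≥ c·g`. -/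
theorem nn_cofactor_complexity_three_pow_le :
    ∃ c : ℝ, 0 < c ∧ ∃ t₀ : ℕ, ∀ (n r g : ℕ), 1 ≤ r → (r + 1) * (2 * r + 1) ≤ n → 2 * g ≤ r → t₀ ≤ g →
      ∀ (hh : MvPolynomial (Fin (2 * n) × Fin (2 * n)) ℝ≥0), hh ≠ 0 →
        ∃ h : ℕ, c * g ≤ h ∧
          3 ^ (h - adim (suppPts hh)) ≤
            (3 * complexity (nestFreeMatchingPoly n ℝ≥0 * hh) + 1) * 2 ^ (h - adim (suppPts hh)) := by
  obtain ⟨c, hc, t₀, H⟩ := nn_cofactor_three_pow_le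
  refine ⟨c, hc, t₀, fun n r g hr hn hg ht hh hh0 => ?_⟩
  have hEF := hasEFOfSize_newtonPolytope_complexity (nestFreeMatchingPoly n ℝ≥0 * hh)
  rw [map_mul, newtonPolytope_mul] at hEF
  exact H n r g hr hn hg ht hh hh0 _ hEF

end Transport


/-! ## §6 The GENERIC EXPOSURE TEMPLATE and the CONTRACTION EXPOSURE RUNG (faces `F_π`, general `Q`)
(crit-9 ADVISORY #2 / VERDICT #8b: the generic-`C` half).  The §3 argument only used: a DOMINANT valid functional
`d` of `COR(n)` that is `= κ` on a vertex family `onFace` and `≤ κ - 1` off it, a finite TEST family `ψ_t` bounded by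
`1` on vertices and constant on the face, the separation hypothesis (H) «no two distinct generators differ by a
common zero of the tests», and unique-disjointness data `A, B` of size `m` inside the face.  We record it once in
that generality and instantiate it on the BLOCK-CONTRACTION faces `F_π` (`π` given by a block map
`blk : Fin n → Fin m` with a section `rep`): dominant functional `-#{(p,p') same block : p ∈ b, p' ∉ b}`, tests
`X_pq - X_p'q'` for block-equivalent cells, UDISJ data `b' ↦ ⋃_{i∈b'} block i`, `a' ↦ rep(a')`. -/

/-- **GENERIC EXPOSURE TEMPLATE.** -/
theorem corPolytope_add_generic_three_pow_le {n m r : ℕ} {Q : Set (Fin (n * n) → ℝ)}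
    (h : HasEFOfSize (corPolytope n + Q) r) {J : Type} [Fintype J] [Nonempty J] [DecidableEq J]
    (q : J → (Fin (n * n) → ℝ)) (hq : ∀ j, q j ∈ Q) (hQ : Q ⊆ convexHull ℝ (Set.range q))
    {T : Type} [Fintype T] [DecidableEq T] (ψ : T → (Fin (n * n) → ℝ)) (d : Fin (n * n) → ℝ)
    (onFace : Finset (Fin n) → Prop) (b₀ : Finset (Fin n)) (κ : ℝ)
    (hd_face : ∀ b, onFace b → d ⬝ᵥ udPt b = κ) (hd_off : ∀ b, ¬ onFace b → d ⬝ᵥ udPt b ≤ κ - 1)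
    (hψ_abs : ∀ t b, |ψ t ⬝ᵥ udPt b| ≤ 1) (hψ_face : ∀ t b, onFace b → ψ t ⬝ᵥ udPt b = ψ t ⬝ᵥ udPt b₀)
    (hsep : ∀ j j', (∀ t, ψ t ⬝ᵥ (q j - q j') = 0) → q j = q j')
    (A B : Finset (Fin m) → Finset (Fin n)) (hBface : ∀ b', onFace (B b'))
    (hAB : ∀ a' b', (A a' ∩ B b').card = (a' ∩ b').card) :
    3 ^ m ≤ (r + 1) * 2 ^ m := by
  classical
  obtain ⟨pt_mem, cc_valid, slack, diag_pt⟩ := ud_data n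
  -- (1) a generic combination of the tests
  let BAD : Finset (J × J) := Finset.univ.filter fun jj => q jj.1 ≠ q jj.2
  obtain ⟨ε, hε⟩ := exists_generic_comb (K := T) BAD (fun t (jj : J × J) => ψ t ⬝ᵥ (q jj.1 - q jj.2))
  let ev : Fin (n * n) → ℝ := ∑ t, ε t • ψ t
  have hev : ∀ x, ev ⬝ᵥ x = ∑ t, ε t * (ψ t ⬝ᵥ x) := by
    intro x
    simp only [ev, sum_dotProduct, smul_dotProduct, smul_eq_mul]
  -- (2) the dominant part, avoiding the remaining coincidences
  have hpairs : ∀ p ∈ BAD.image (fun jj => (d ⬝ᵥ (q jj.1 - q jj.2), ev ⬝ᵥ (q jj.1 - q jj.2))),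
      p.1 ≠ 0 ∨ p.2 ≠ 0 := by
    intro p hp
    obtain ⟨jj, hjj, rfl⟩ := Finset.mem_image.1 hp
    by_contra hcon
    push Not at hcon
    have hbad : q jj.1 ≠ q jj.2 := (Finset.mem_filter.1 hjj).2
    apply hbad
    apply hsep
    intro t
    by_contra ht
    have hne := hε jj hjj ⟨t, ht⟩
    rw [← hev] at hne
    exact hne hcon.2
  obtain ⟨M, hMC, hM⟩ := exists_large_avoid _ hpairs (2 * ∑ t, |ε t|)
  set w : Fin (n * n) → ℝ := M • d + ev with hw
  have hwdot : ∀ x, w ⬝ᵥ x = M * (d ⬝ᵥ x) + ev ⬝ᵥ x := by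
    intro x; rw [hw, add_dotProduct, smul_dotProduct, smul_eq_mul]
  have hwsep : ∀ j j', q j ≠ q j' → w ⬝ᵥ q j ≠ w ⬝ᵥ q j' := by
    intro j j' hne heq
    have hmem : (d ⬝ᵥ (q j - q j'), ev ⬝ᵥ (q j - q j')) ∈
        BAD.image (fun jj => (d ⬝ᵥ (q jj.1 - q jj.2), ev ⬝ᵥ (q jj.1 - q jj.2))) :=
      Finset.mem_image.2 ⟨(j, j'), Finset.mem_filter.2 ⟨Finset.mem_univ _, hne⟩, rfl⟩
    have hne' := hM _ hmem
    apply hne'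
    show d ⬝ᵥ (q j - q j') * M + ev ⬝ᵥ (q j - q j') = 0
    have h1 : w ⬝ᵥ (q j - q j') = 0 := by rw [dotProduct_sub, heq, sub_self]
    rw [hwdot] at h1
    linarith
  -- (3) values on the vertices of `COR(n)`
  have hev_le : ∀ b : Finset (Fin n), |ev ⬝ᵥ udPt b| ≤ ∑ t, |ε t| := by
    intro b
    rw [hev]
    refine (Finset.abs_sum_le_sum_abs _ _).trans ?_
    refine Finset.sum_le_sum fun t _ => ?_
    rw [abs_mul]
    exact mul_le_of_le_one_right (abs_nonneg _) (hψ_abs t b)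
  have hev_face : ∀ b : Finset (Fin n), onFace b → ev ⬝ᵥ udPt b = ev ⬝ᵥ udPt b₀ := by
    intro b hb
    rw [hev, hev]
    exact Finset.sum_congr rfl fun t _ => by rw [hψ_face t b hb]
  set δP : ℝ := M * κ + ev ⬝ᵥ udPt b₀ with hδP
  have hMpos : 0 ≤ M := by
    have : (0 : ℝ) ≤ 2 * ∑ t, |ε t| := by positivity
    linarith
  have hw_vert : ∀ b : Finset (Fin n), w ⬝ᵥ udPt b ≤ δP := by
    intro b
    rw [hwdot]
    by_cases hb : onFace b
    · rw [hd_face b hb, hev_face b hb]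
    · have h1 := hd_off b hb
      have h2 := hev_le b
      have h3 := hev_le b₀
      rw [abs_le] at h2 h3
      have h4 : M * (d ⬝ᵥ udPt b) ≤ M * (κ - 1) := mul_le_mul_of_nonneg_left h1 hMpos
      linarith [h2.2, h3.1]
  have hw_face : ∀ b : Finset (Fin n), onFace b → w ⬝ᵥ udPt b = δP := by
    intro b hb
    rw [hwdot, hd_face b hb, hev_face b hb]
  have hgen : ∀ y ∈ Set.range (fun a : Cube n => vecOuter n (bvec a)), w ⬝ᵥ y ≤ δP := by
    rintro _ ⟨a, rfl⟩
    have hpt : vecOuter n (bvec a) = udPt (Finset.univ.filter fun i => a i = true) := by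
      unfold udPt
      congr 1
      funext i
      rw [udInd_apply]
      simp [bvec]
    show w ⬝ᵥ vecOuter n (bvec a) ≤ δP
    rw [hpt]
    exact hw_vert _
  have hwP : ∀ x ∈ corPolytope n, w ⬝ᵥ x ≤ δP := fun x hx =>
    dot_le_of_mem_convexHull _ w δP hgen x hx
  -- (4) the face of `Q`: a single point
  obtain ⟨j₀, -, hj₀⟩ :=
    Finset.exists_max_image Finset.univ (fun j => w ⬝ᵥ q j) Finset.univ_nonempty
  have hmax : ∀ j, w ⬝ᵥ q j ≤ w ⬝ᵥ q j₀ := fun j => hj₀ j (Finset.mem_univ j)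
  set δQ := w ⬝ᵥ q j₀ with hδQ
  have hwQ : ∀ y ∈ Q, w ⬝ᵥ y ≤ δQ := fun y hy =>
    dot_le_of_mem_convexHull _ w δQ (by rintro _ ⟨j, rfl⟩; exact hmax j) y (hQ hy)
  have hFG := hasEFOfSize_face_add h w δP δQ hwP hwQ
  have hmaxpt : ∀ j, w ⬝ᵥ q j = δQ → q j = q j₀ := by
    intro j hj
    by_contra hne
    exact hwsep j j₀ hne (by rw [hj])
  have hQface : Q ∩ {y | w ⬝ᵥ y = δQ} ⊆ convexHull ℝ (Set.range fun _ : Fin 1 => q j₀) := by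
    rintro y ⟨hy, hyw⟩
    have hy' := mem_convexHull_maximisers q w δQ hmax (hQ hy) hyw
    have hsub : Set.range (fun j : {j : J // w ⬝ᵥ q j = δQ} => q j.1) ⊆ {q j₀} := by
      rintro _ ⟨j, rfl⟩; exact hmaxpt j.1 j.2
    have hy1 : y ∈ convexHull ℝ ({q j₀} : Set (Fin (n * n) → ℝ)) := convexHull_mono hsub hy'
    rw [convexHull_singleton] at hy1
    rw [Set.mem_singleton_iff.1 hy1]
    exact subset_convexHull ℝ _ ⟨0, rfl⟩
  -- (5) the unique-disjointness data of the face
  have key := three_pow_le_of_add (α := Fin m) hFG (fun b' => udPt (B b'))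
    (fun b' => ⟨pt_mem _, hw_face _ (hBface b')⟩) (fun a' => udRow (A a'))
    (fun _ => 1) (fun a' x hx => cc_valid (A a') x hx.1) ?_ ?_
    (fun _ : Fin 1 => q j₀) (fun _ => ⟨hq j₀, rfl⟩) hQface
  · simpa [Fintype.card_fin] using key
  · intro a' b' hlt hone
    have := slack (A a') (B b')
    rw [hAB, hone] at this
    norm_num at this
    linarith
  · intro a' b' hab
    have := slack (A a') (B b')
    rw [hAB, Finset.disjoint_iff_inter_eq_empty.1 hab, Finset.card_empty] at this
    norm_num at this
    linarith

section Contraction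

variable {m : ℕ} (blk : Fin n → Fin m)

theorem udInd_nonneg (b : Finset (Fin n)) (p : Fin n) : 0 ≤ udInd b p := by
  rw [udInd_apply]; split_ifs <;> norm_num

theorem udInd_le_one (b : Finset (Fin n)) (p : Fin n) : udInd b p ≤ 1 := by
  rw [udInd_apply]; split_ifs <;> norm_num

theorem udInd_mul_self (b : Finset (Fin n)) (p : Fin n) : udInd b p * udInd b p = udInd b p := by
  rw [udInd_apply]; split_ifs <;> norm_num

theorem udInd_eq_one {b : Finset (Fin n)} {p : Fin n} (hp : p ∈ b) : udInd b p = 1 := by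
  rw [udInd_apply, if_pos hp]

theorem udInd_eq_zero {b : Finset (Fin n)} {p : Fin n} (hp : p ∉ b) : udInd b p = 0 := by
  rw [udInd_apply, if_neg hp]

/-- the tests of the contraction face `F_π`: `X_pq - X_p'q'` for block-equivalent cells `(p,q) ~ (p',q')`. -/
def cpsi : (Fin n × Fin n) × (Fin n × Fin n) → (Fin (n * n) → ℝ)
  | ((p, q), (p', q')) => if blk p = blk p' ∧ blk q = blk q' then ent n p q - ent n p' q' else 0

/-- the dominant functional of `F_π`: minus the number of same-block pairs `(p ∈ b, p' ∉ b)`. -/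
def cdom : Fin (n * n) → ℝ :=
  -∑ p : Fin n, ∑ p' : Fin n, if blk p = blk p' then ent n p p - ent n p p' else 0

/-- the vertex family of `F_π`: block-constant `0/1` points. -/
def BlockConst (b : Finset (Fin n)) : Prop := ∀ p p', blk p = blk p' → (p ∈ b ↔ p' ∈ b)

/-- the summand of `-cdom · udPt b` at `(p, p')`. -/
def cterm (b : Finset (Fin n)) (p p' : Fin n) : ℝ :=
  if blk p = blk p' then udInd b p * (1 - udInd b p') else 0

theorem cdom_dot_udPt (b : Finset (Fin n)) :
    cdom blk ⬝ᵥ udPt b = -∑ p : Fin n, ∑ p' : Fin n, cterm blk b p p' := by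
  unfold cdom
  rw [neg_dotProduct, sum_dotProduct]
  congr 1
  refine Finset.sum_congr rfl fun p _ => ?_
  rw [sum_dotProduct]
  refine Finset.sum_congr rfl fun p' _ => ?_
  unfold cterm
  by_cases hb : blk p = blk p'
  · rw [if_pos hb, if_pos hb, sub_dotProduct, ent_dot_udPt, ent_dot_udPt, udInd_mul_self]
    ring
  · rw [if_neg hb, if_neg hb, zero_dotProduct]

theorem cterm_nonneg (b : Finset (Fin n)) (p p' : Fin n) : 0 ≤ cterm blk b p p' := by
  unfold cterm
  split_ifs
  · exact mul_nonneg (udInd_nonneg b p) (sub_nonneg.2 (udInd_le_one b p'))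
  · exact le_rfl

theorem cdom_face (b : Finset (Fin n)) (hb : BlockConst blk b) : cdom blk ⬝ᵥ udPt b = 0 := by
  rw [cdom_dot_udPt, neg_eq_zero]
  refine Finset.sum_eq_zero fun p _ => Finset.sum_eq_zero fun p' _ => ?_
  unfold cterm
  by_cases hpp : blk p = blk p'
  · rw [if_pos hpp]
    by_cases hp : p ∈ b
    · rw [udInd_eq_one ((hb p p' hpp).1 hp)]; ring
    · rw [udInd_eq_zero hp]; ring
  · rw [if_neg hpp]

theorem cdom_off (b : Finset (Fin n)) (hb : ¬ BlockConst blk b) : cdom blk ⬝ᵥ udPt b ≤ 0 - 1 := by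
  rw [cdom_dot_udPt]
  have hex : ∃ p p', blk p = blk p' ∧ p ∈ b ∧ p' ∉ b := by
    by_contra hcon
    push Not at hcon
    apply hb
    intro p p' hpp
    constructor
    · intro hp; exact hcon p p' hpp hp
    · intro hp'
      by_contra hp
      exact hp (hcon p' p hpp.symm hp')
  obtain ⟨p, p', hpp, hp, hp'⟩ := hex
  have hterm : cterm blk b p p' = 1 := by
    unfold cterm
    rw [if_pos hpp, udInd_eq_one hp, udInd_eq_zero hp']
    ring
  have h1 : cterm blk b p p' ≤ ∑ x' : Fin n, cterm blk b p x' :=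
    Finset.single_le_sum (f := fun x' => cterm blk b p x') (fun x' _ => cterm_nonneg blk b p x')
      (Finset.mem_univ p')
  have h2 : ∑ x' : Fin n, cterm blk b p x' ≤ ∑ x : Fin n, ∑ x' : Fin n, cterm blk b x x' :=
    Finset.single_le_sum (f := fun x => ∑ x' : Fin n, cterm blk b x x')
      (fun x _ => Finset.sum_nonneg fun x' _ => cterm_nonneg blk b x x') (Finset.mem_univ p)
  linarith

theorem cpsi_dot_udPt (p q p' q' : Fin n) (b : Finset (Fin n)) :
    cpsi blk ((p, q), (p', q')) ⬝ᵥ udPt b =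
      if blk p = blk p' ∧ blk q = blk q' then udInd b p * udInd b q - udInd b p' * udInd b q' else 0 := by
  show (if blk p = blk p' ∧ blk q = blk q' then ent n p q - ent n p' q' else 0) ⬝ᵥ udPt b = _
  by_cases hc : blk p = blk p' ∧ blk q = blk q'
  · rw [if_pos hc, if_pos hc, sub_dotProduct, ent_dot_udPt, ent_dot_udPt]
  · rw [if_neg hc, if_neg hc, zero_dotProduct]

theorem cpsi_abs_le (t : (Fin n × Fin n) × (Fin n × Fin n)) (b : Finset (Fin n)) :
    |cpsi blk t ⬝ᵥ udPt b| ≤ 1 := by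
  obtain ⟨⟨p, q⟩, ⟨p', q'⟩⟩ := t
  rw [cpsi_dot_udPt]
  by_cases hc : blk p = blk p' ∧ blk q = blk q'
  · rw [if_pos hc, udInd_apply, udInd_apply, udInd_apply, udInd_apply]
    split_ifs <;> norm_num
  · rw [if_neg hc]; norm_num

theorem cpsi_face_zero (t : (Fin n × Fin n) × (Fin n × Fin n)) (b : Finset (Fin n))
    (hb : BlockConst blk b) : cpsi blk t ⬝ᵥ udPt b = 0 := by
  obtain ⟨⟨p, q⟩, ⟨p', q'⟩⟩ := t
  rw [cpsi_dot_udPt]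
  by_cases hc : blk p = blk p' ∧ blk q = blk q'
  · rw [if_pos hc]
    have e1 : udInd b p = udInd b p' := by
      by_cases hp : p ∈ b
      · rw [udInd_eq_one hp, udInd_eq_one ((hb p p' hc.1).1 hp)]
      · rw [udInd_eq_zero hp, udInd_eq_zero (fun h' => hp ((hb p p' hc.1).2 h'))]
    have e2 : udInd b q = udInd b q' := by
      by_cases hq : q ∈ b
      · rw [udInd_eq_one hq, udInd_eq_one ((hb q q' hc.2).1 hq)]
      · rw [udInd_eq_zero hq, udInd_eq_zero (fun h' => hq ((hb q q' hc.2).2 h'))]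
    rw [e1, e2, sub_self]
  · rw [if_neg hc]

theorem blockConst_empty : BlockConst blk (∅ : Finset (Fin n)) := fun p p' _ => by simp

theorem cpsi_face (t : (Fin n × Fin n) × (Fin n × Fin n)) (b : Finset (Fin n)) (hb : BlockConst blk b) :
    cpsi blk t ⬝ᵥ udPt b = cpsi blk t ⬝ᵥ udPt ∅ := by
  rw [cpsi_face_zero blk t b hb, cpsi_face_zero blk t ∅ (blockConst_empty blk)]

/-- ★★ **THE CONTRACTION EXPOSURE RUNG (PROVED).**  `π` a block structure on `Fin n` with `m` represented blocks
(`blk ∘ rep = id`).  If no two distinct generators of the passenger differ by a common zero of the contraction tests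
— i.e. by a matrix that is BLOCK-CONSTANT (`D_pq = D_p'q'` whenever `p ~ p'`, `q ~ q'`; = `lin F_π`, crit-9's Step 2)
— then every extended formulation of `COR(n) + Q` has size `≥ 1.5^m - 1`. -/
theorem corPolytope_add_genericContraction_three_pow_le {r : ℕ} {Q : Set (Fin (n * n) → ℝ)}
    (h : HasEFOfSize (corPolytope n + Q) r) {J : Type} [Fintype J] [Nonempty J] [DecidableEq J]
    (q : J → (Fin (n * n) → ℝ)) (hq : ∀ j, q j ∈ Q) (hQ : Q ⊆ convexHull ℝ (Set.range q))
    (rep : Fin m → Fin n) (hrep : ∀ i, blk (rep i) = i)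
    (hsep : ∀ j j', (∀ t, cpsi blk t ⬝ᵥ (q j - q j') = 0) → q j = q j') :
    3 ^ m ≤ (r + 1) * 2 ^ m := by
  classical
  have hrinj : Function.Injective rep := fun i i' h => by rw [← hrep i, ← hrep i', h]
  let B : Finset (Fin m) → Finset (Fin n) := fun b' => Finset.univ.filter fun p => blk p ∈ b'
  let A : Finset (Fin m) → Finset (Fin n) := fun a' => a'.image rep
  refine corPolytope_add_generic_three_pow_le h q hq hQ (cpsi blk) (cdom blk) (BlockConst blk) ∅ 0
    (cdom_face blk) (cdom_off blk) (cpsi_abs_le blk) (cpsi_face blk) hsep A B ?_ ?_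
  · intro b' p p' hpp
    simp [B, hpp]
  · intro a' b'
    have h1 : A a' ∩ B b' = (a' ∩ b').image rep := by
      ext p
      simp only [A, B, Finset.mem_inter, Finset.mem_image, Finset.mem_filter, Finset.mem_univ, true_and]
      constructor
      · rintro ⟨⟨i, hi, rfl⟩, hb⟩
        rw [hrep] at hb
        exact ⟨i, ⟨hi, hb⟩, rfl⟩
      · rintro ⟨i, ⟨hi, hb⟩, rfl⟩
        exact ⟨⟨i, hi, rfl⟩, by rw [hrep]; exact hb⟩
    rw [h1, Finset.card_image_of_injective _ hrinj]

end Contraction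


/-! ## §7 AT THE ROUTE RATE, IN THE CRUX'S LITERAL CURRENCY: `NNDivisionHard` restricted to the cofactor class
`{hh ≠ 0 : dim aff supp(hh) ≤ κ·√n}` HOLDS (unconditionally).  COR level: passengers with `2·dim aff Q ≤ h` are
`T c h`-hard eventually (dimension rung + c1's `growth_eventually`); NN level: the transport with dimension + the
threshold arithmetic of `xcTransport_holds` (`T_pow_four_le`). -/

section RouteRate

open MvPolynomial
open scoped NNReal
open Literature.Computability.AlgebraicComplexity (complexity nestFreeMatchingPoly)
open Literature.Computability.AlgebraicComplexity.MonotoneCircuitEF (hasEFOfSize_newtonPolytope_complexity)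
open Literature.Algebra.Polynomial.NewtonPolytope (newtonPolytope newtonPolytope_mul)
open Summit.ValiantsHypothesis.ValiantsHypothesis.Theorems.FifoMatching.QueueGridFace (suppPts growth_eventually)

/-- **COR level, restricted to low-dimensional passengers (PROVED):** for every `c`, eventually in `h`, every
passenger family `q` with `2·dim aff {q} ≤ h` gives `xc(COR(K_h) + conv q) > T c h`. -/
theorem corMinkowskiHard_lowdim (c : ℕ) : ∃ h₀ : ℕ, ∀ h ≥ h₀, ∀ {J : Type} [Fintype J] [Nonempty J]
    (q : J → (Fin h × Fin h → ℝ)) (r : ℕ), 2 * adim (Set.range q) ≤ h →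
      HasEFOfSize (corPolytopeGraph (⊤ : SimpleGraph (Fin h)) + convexHull ℝ (Set.range q)) r → T c h < r := by
  obtain ⟨r₀, hr₀2, hgrowth⟩ := growth_eventually c (c := (1 / 2 : ℝ)) (by norm_num)
  refine ⟨r₀, fun h hh J _ _ q r hdim hEF => ?_⟩
  classical
  have hrung := corPolytopeGraph_top_add_hull_three_pow_le_of_finrank q hEF
  have hk : 3 ^ (h / 2) ≤ (r + 1) * 2 ^ (h / 2) :=
    three_two_descend (by unfold adim at hdim; omega) hrung
  -- in ℝ: `(3/2)^(h/2) ≤ r + 1`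
  have hkR : (3 : ℝ) ^ (h / 2) ≤ ((r : ℝ) + 1) * 2 ^ (h / 2) := by exact_mod_cast hk
  have h32 : ((3 : ℝ) / 2) ^ (h / 2) ≤ (r : ℝ) + 1 := by
    rw [div_pow, div_le_iff₀ (by positivity)]
    exact hkR
  -- `2^((1/2)·(h/2)) ≤ (3/2)^(h/2)`
  have hsqrt : (2 : ℝ) ^ ((1 / 2 : ℝ) * ((h / 2 : ℕ) : ℝ)) ≤ ((3 : ℝ) / 2) ^ (h / 2) := by
    rw [Real.rpow_mul (by norm_num), Real.rpow_natCast]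
    refine pow_le_pow_left₀ (by positivity) ?_ _
    rw [← Real.sqrt_eq_rpow]
    calc Real.sqrt 2 ≤ Real.sqrt (((3 : ℝ) / 2) ^ 2) := Real.sqrt_le_sqrt (by norm_num)
      _ = 3 / 2 := Real.sqrt_sq (by norm_num)
  have hg := hgrowth h hh
  have hT : ((T c h : ℕ) : ℝ) = (2 : ℝ) ^ ((Nat.log 2 h + c) ^ c) := by
    unfold T; push_cast; ring
  have h4 : (1 : ℝ) ≤ (h : ℝ) ^ 4 := one_le_pow₀ (by exact_mod_cast (show 1 ≤ h by omega))
  have : ((T c h : ℕ) : ℝ) < r := by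
    rw [hT]
    by_contra hcon
    push Not at hcon
    linarith
  exact_mod_cast this

/-- ★★★ **`NNDivisionHard` ON THE LOW-DIMENSIONAL COFACTOR CLASS (PROVED, unconditional):** there is `κ > 0` such
that for every `c`, eventually in `n`, every cofactor `hh ≠ 0` over `ℝ≥0` whose support spans an affine space of
dimension `≤ κ·√n` satisfies the crux's inequality `T c n < L₊(NN_n · hh) + L₊(hh)` — indeed `T c n < L₊(NN_n · hh)`.
No condition on degrees, number of monomials, `hh(0)`, or signs. -/
theorem nnDivisionHard_lowdim : ∃ κ : ℝ, 0 < κ ∧ ∀ c : ℕ, ∃ n₀ : ℕ, ∀ n ≥ n₀,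
    ∀ hh : MvPolynomial (Fin (2 * n) × Fin (2 * n)) ℝ≥0, hh ≠ 0 →
      (adim (suppPts hh) : ℝ) ≤ κ * Real.sqrt n →
        T c n < complexity (nestFreeMatchingPoly n ℝ≥0 * hh) + complexity hh := by
  obtain ⟨cA, hcA, t₀, htrans⟩ := transport_geometric_dim
  set cm : ℝ := min cA 1 with hcm
  have hcm0 : 0 < cm := lt_min hcA one_pos
  have hcmA : cm ≤ cA := min_le_left _ _
  have hcm1 : cm ≤ 1 := min_le_right _ _
  refine ⟨cm / 64, by positivity, fun c => ?_⟩
  obtain ⟨h₀, hh₀⟩ := corMinkowskiHard_lowdim (4 ^ (c + 1) + c + 1)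
  obtain ⟨S₁, hS₁⟩ := exists_nat_ge ((20 / cm) ^ 2)
  obtain ⟨S₀, hS₀a, hS₀b, hS₀c, hS₀d⟩ :
      ∃ S₀ : ℕ, 4 * t₀ + 4 ≤ S₀ ∧ h₀ ^ 2 ≤ S₀ ∧ S₁ ≤ S₀ ∧ 16 ≤ S₀ :=
    ⟨4 * t₀ + 4 + h₀ ^ 2 + S₁ + 16, by omega, by omega, by omega, by omega⟩
  refine ⟨S₀ ^ 2, fun n hn hh hh0 hdim => ?_⟩
  -- an EF of `Newt(NN_n) + Newt(hh)` of size `3·T c n` from a small circuit for `NN_n · hh`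
  by_contra hle
  push Not at hle
  have hEF : HasEFOfSize (newtR (nestFreeMatchingPoly n ℝ≥0) + newtR hh) (3 * T c n) := by
    have h1 := hasEFOfSize_newtonPolytope_complexity (nestFreeMatchingPoly n ℝ≥0 * hh)
    rw [map_mul, newtonPolytope_mul] at h1
    exact h1.of_le (by omega)
  obtain ⟨s, hs⟩ : ∃ s, s = Nat.sqrt n := ⟨_, rfl⟩
  have hsS : S₀ ≤ s := by rw [hs]; exact Nat.le_sqrt'.2 hn
  have hss : s ^ 2 ≤ n := by rw [hs]; exact Nat.sqrt_le' n
  have hns : n < (s + 1) ^ 2 := by rw [hs]; exact Nat.lt_succ_sqrt' n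
  obtain ⟨g, hg⟩ : ∃ g, g = s / 4 := ⟨_, rfl⟩
  have h4g : 4 * g ≤ s := by rw [hg]; exact Nat.mul_div_le s 4
  have hg4 : s < 4 * (g + 1) := by rw [hg]; omega
  have hg1 : 1 ≤ g := by omega
  have hgt : t₀ ≤ g := by omega
  have hn' : (2 * g + 1) * (2 * (2 * g) + 1) ≤ n := by nlinarith [Nat.mul_le_mul h4g h4g]
  obtain ⟨h, hch, K, q, hEF', hdq⟩ :=
    htrans n (2 * g) g (by omega) hn' (le_refl _) hgt hh hh0 (3 * T c n) hEF
  -- `h` is large: `h ≥ √s + 1`, and `h ≥ cm (s/4 - 1)`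
  have hsqrt_s : Real.sqrt s * Real.sqrt s = s := Real.mul_self_sqrt (Nat.cast_nonneg s)
  have hg_real : (s : ℝ) / 4 - 1 ≤ g := by
    have : (s : ℝ) < 4 * ((g : ℝ) + 1) := by exact_mod_cast hg4
    linarith
  have h1 : cm * ((s : ℝ) / 4 - 1) ≤ h :=
    calc cm * ((s : ℝ) / 4 - 1) ≤ cm * g := mul_le_mul_of_nonneg_left hg_real hcm0.le
      _ ≤ cA * g := mul_le_mul_of_nonneg_right hcmA (Nat.cast_nonneg g)
      _ ≤ h := hch
  have hreal : Real.sqrt s + 1 ≤ (h : ℝ) := by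
    have hS₁s : ((20 / cm) ^ 2 : ℝ) ≤ s := le_trans hS₁ (by exact_mod_cast (show S₁ ≤ s by omega))
    have hsq : 20 / cm ≤ Real.sqrt s := by
      rw [show (20 / cm : ℝ) = Real.sqrt ((20 / cm) ^ 2) by rw [Real.sqrt_sq (by positivity)]]
      exact Real.sqrt_le_sqrt hS₁s
    have h20 : 20 ≤ cm * Real.sqrt s := by
      have := mul_le_mul_of_nonneg_left hsq hcm0.le
      rwa [show cm * (20 / cm) = 20 by field_simp] at this
    have h2 : 20 * Real.sqrt s ≤ cm * s := by
      have := mul_le_mul_of_nonneg_right h20 (Real.sqrt_nonneg s)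
      rw [mul_assoc, hsqrt_s] at this
      exact this
    have hs1 : 1 ≤ Real.sqrt s := by
      rw [show (1 : ℝ) = Real.sqrt 1 by simp]
      exact Real.sqrt_le_sqrt (by exact_mod_cast (show 1 ≤ s by omega))
    nlinarith
  have hh₀' : h₀ ≤ h := by
    have : (h₀ : ℝ) ≤ Real.sqrt s := by
      rw [show (h₀ : ℝ) = Real.sqrt ((h₀ : ℝ) ^ 2) by rw [Real.sqrt_sq (Nat.cast_nonneg _)]]
      exact Real.sqrt_le_sqrt (by exact_mod_cast (show h₀ ^ 2 ≤ s by omega))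
    exact_mod_cast (by linarith : (h₀ : ℝ) ≤ h)
  have hn4 : n < h ^ 4 := by
    have hs1 : s + 1 ≤ h ^ 2 := by
      have : (s : ℝ) + 1 ≤ (h : ℝ) ^ 2 := by nlinarith [Real.sqrt_nonneg s]
      exact_mod_cast this
    calc n < (s + 1) ^ 2 := hns
      _ ≤ (h ^ 2) ^ 2 := Nat.pow_le_pow_left hs1 2
      _ = h ^ 4 := by rw [← pow_mul]
  have hn0 : n ≠ 0 := by
    have : 16 ^ 2 ≤ s ^ 2 := Nat.pow_le_pow_left (by omega) 2
    omega
  -- the dimension side condition `2·dim ≤ h`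
  have hdim' : 2 * adim (Set.range q) ≤ h := by
    have hsqn : Real.sqrt n ≤ (s : ℝ) + 1 := by
      calc Real.sqrt n ≤ Real.sqrt (((s : ℝ) + 1) ^ 2) :=
            Real.sqrt_le_sqrt (by exact_mod_cast hns.le)
        _ = (s : ℝ) + 1 := Real.sqrt_sq (by positivity)
    have hd1 : ((adim (Set.range q) : ℕ) : ℝ) ≤ cm / 64 * ((s : ℝ) + 1) :=
      calc ((adim (Set.range q) : ℕ) : ℝ) ≤ adim (suppPts hh) := by exact_mod_cast hdq
        _ ≤ cm / 64 * Real.sqrt n := hdim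
        _ ≤ cm / 64 * ((s : ℝ) + 1) := mul_le_mul_of_nonneg_left hsqn (by positivity)
    have hs16 : (16 : ℝ) ≤ s := by exact_mod_cast (show 16 ≤ s by omega)
    have : 2 * ((adim (Set.range q) : ℕ) : ℝ) ≤ h := by nlinarith
    exact_mod_cast this
  have hT := T_pow_four_le (c := c) hn0 hn4
  have hlt := hh₀ h hh₀' q (3 * T c n) hdim' hEF'
  have hT2 : 2 ≤ T c n := by
    show 2 ^ 1 ≤ 2 ^ _
    exact Nat.pow_le_pow_right (by norm_num)
      (Nat.one_le_pow _ _ (by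
        have h256 : 16 ^ 2 ≤ S₀ ^ 2 := Nat.pow_le_pow_left hS₀d 2
        have := Nat.log_pos one_lt_two (show 2 ≤ n by omega)
        omega))
  have h8 : 8 * T c n ≤ (T c n) ^ 4 := by
    have : 2 ^ 3 ≤ (T c n) ^ 3 := Nat.pow_le_pow_left hT2 3
    calc 8 * T c n = 2 ^ 3 * T c n := by norm_num
      _ ≤ (T c n) ^ 3 * T c n := Nat.mul_le_mul_right _ this
      _ = (T c n) ^ 4 := by ring
  omega

end RouteRate

end Summit.ValiantsHypothesis.ValiantsHypothesis.Cruxes.NNDivisionHard.ValIdea40.Flat
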